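import Mathlib
import HarnessLib
import Literature.Geometry.Lorentzian.KerrSchildDivergence
import Literature.Geometry.Lorentzian.KerrSchildCoord
import Literature.Geometry.Lorentzian.SpacetimeLocalConvergenceChartOrientation
import Literature.Geometry.Lorentzian.BackgroundChartCalculus
import Literature.Geometry.Lorentzian.TimeCones

/-!
# Lever kit for card A (`frozen-null-line-transport`), kernel-checked (crux `FutureOrientedOfSeamed`,
# stmt-FinalStateConjecture-17576; crux-ideate round 1, ideator 1). EVIDENCE ONLY.

* `kerr_bilin_frozen_timeVector_le` (A1): the frozen time vector stays uniformly Kerr-timelike along the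
  in-slab outward principal-null-plus-time line (margin `1`);
* `kerr_bilin_basisVector_frozen_timeVector_le` (A1'): its pairing with `e₀` (the SEAMED (5) anchor direction)
  is `≤ −1 + 2H(x)`;
* `isFutureDirected_mfderiv_of_segment` (A2): the tree's constant-vector orientation lemma
  `Spacetime.isFutureDirected_mfderiv_of_isPreconnected` on a coordinate SEGMENT, for subtype-domain charts;
* `isTimelike_mfderiv_of_norm_deviation_le` (A3), `isFutureDirected_mfderiv_of_pairing_neg` (A4): the two
  pointwise conversions (C⁰ deviation ⇒ timelike; negative pairing ⇒ same cone).
-/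

open scoped Topology Manifold ContDiff
open Set

noncomputable section

namespace Summit.FinalStateConjecture.FinalStateConjecture.Cruxes.FutureOrientedOfSeamed.Ideator1

open Literature.Geometry.Lorentzian

set_option linter.dupNamespace false

/-- `Σ ≤ 3 r²` wherever `|a| ≤ r` (`Σ = 2r² − ‖x⃗‖² + a²`). -/
theorem blSigma_spatial_le {a : ℝ} {x : E4} (ha : |a| ≤ Kerr.radius a x) :
    Kerr.blSigma a (E4.spatial x) ≤ 3 * Kerr.radius a x ^ 2 := by
  rw [Kerr.blSigma_spatial_eq]
  have h1 : a ^ 2 ≤ Kerr.radius a x ^ 2 := sq_le_sq' (abs_le.mp ha).1 (abs_le.mp ha).2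
  nlinarith [sq_nonneg (E4.spatialNorm x)]

/-- **`H` at most doubles along the outward null line**: `H(x + s ℓ♯ₓ) ≤ 2 H(x)` for `s ≥ 0`,
`|a| ≤ r(x)` (`H(s) = M (r + s)/(Σ + 2 r s + s²)`, `Σ ≤ 3 r²`). -/
theorem scalarH_add_smul_nullVector_le {M a : ℝ} (hM : 0 ≤ M) {x : E4}
    (hr : 0 < Kerr.radius a x) (ha : |a| ≤ Kerr.radius a x) {s : ℝ} (hs : 0 ≤ s) :
    Kerr.scalarH M a (x + s • Kerr.nullVector a x) ≤ 2 * Kerr.scalarH M a x := by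
  have hs' : 0 < Kerr.radius a x + s := by linarith
  have hry : Kerr.radius a (x + s • Kerr.nullVector a x) = Kerr.radius a x + s :=
    Kerr.radius_add_smul_nullVector hr hs'
  have hry0 : 0 < Kerr.radius a (x + s • Kerr.nullVector a x) := by rw [hry]; exact hs'
  have hSig0 : 0 < Kerr.blSigma a (E4.spatial x) := Kerr.blSigma_spatial_pos hr
  have hSigy : Kerr.blSigma a (E4.spatial (x + s • Kerr.nullVector a x)) =
      Kerr.blSigma a (E4.spatial x) + 2 * Kerr.radius a x * s + s ^ 2 :=
    Kerr.blSigma_spatial_add_smul_nullVector hr hs'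
  have hSigy0 : 0 < Kerr.blSigma a (E4.spatial x) + 2 * Kerr.radius a x * s + s ^ 2 := by positivity
  have hSigle : Kerr.blSigma a (E4.spatial x) ≤ 3 * Kerr.radius a x ^ 2 := blSigma_spatial_le ha
  rw [Kerr.scalarH_eq_div_blSigma M a hry0, Kerr.scalarH_eq_div_blSigma M a hr, hry, hSigy]
  rw [div_le_iff₀ hSigy0, mul_div_assoc, show 2 * (M * (Kerr.radius a x / Kerr.blSigma a (E4.spatial x))) *
      (Kerr.blSigma a (E4.spatial x) + 2 * Kerr.radius a x * s + s ^ 2) =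
      M * ((2 * Kerr.radius a x * (Kerr.blSigma a (E4.spatial x) + 2 * Kerr.radius a x * s + s ^ 2)) /
        Kerr.blSigma a (E4.spatial x)) by ring]
  refine mul_le_mul_of_nonneg_left ?_ hM
  rw [le_div_iff₀ hSig0]
  set Sg := Kerr.blSigma a (E4.spatial x)
  set r := Kerr.radius a x
  nlinarith [mul_nonneg hs hSig0.le, mul_nonneg hs (sq_nonneg r), mul_nonneg (mul_nonneg hs hs) hr.le,
    mul_le_mul_of_nonneg_left hSigle hs, mul_nonneg hr.le hSig0.le]

/-- **A1 (the lever's margin, kernel-checked).** Along the in-slab line `y(s) = x + s (ℓ♯ₓ + e₀)`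
the time vector frozen at the inner endpoint stays uniformly Kerr-timelike:
`g_{M,a}(y(s))(V(x), V(x)) = −1 − 4H(x) + 2H(x + sℓ♯ₓ) ≤ −1`. -/
theorem kerr_bilin_frozen_timeVector_le {M a : ℝ} (hM : 0 ≤ M) {x : E4}
    (hr : 0 < Kerr.radius a x) (ha : |a| ≤ Kerr.radius a x) {s : ℝ} (hs : 0 ≤ s) :
    Kerr.bilin M a (x + s • (Kerr.nullVector a x + E4.basisVector 0))
      (Kerr.timeVector M a x) (Kerr.timeVector M a x) ≤ -1 := by
  have hs' : 0 < Kerr.radius a x + s := by linarith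
  have hpt : x + s • (Kerr.nullVector a x + E4.basisVector 0) =
      (x + s • Kerr.nullVector a x) + s • E4.basisVector 0 := by
    rw [smul_add, add_assoc]
  rw [hpt, Kerr.bilin_add_smul_basisVector_zero]
  have hℓ : Kerr.nullCovector a (x + s • Kerr.nullVector a x) = Kerr.nullCovector a x := by
    have h : Kerr.nullCovectorFun a (x + s • Kerr.nullVector a x) = Kerr.nullCovectorFun a x :=
      funext fun μ ↦ Kerr.nullCovectorFun_add_smul_nullVector hr hs' μ
    simp only [Kerr.nullCovector, h]
  have hℓV : Kerr.nullCovector a x (Kerr.timeVector M a x) = 1 := by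
    simp only [Kerr.timeVector, map_sub, map_smul, Kerr.nullCovector_basisVector_zero,
      Kerr.nullCovector_nullVector hr, smul_eq_mul, mul_zero, sub_zero]
  have hη : Minkowski.bilin (Kerr.timeVector M a x) (Kerr.timeVector M a x) =
      -1 - 4 * Kerr.scalarH M a x := by
    have h := Kerr.bilin_timeVector_timeVector (M := M) hr
    rw [Kerr.bilin_apply, hℓV] at h
    linarith
  have hH := scalarH_add_smul_nullVector_le hM hr ha hs
  rw [Kerr.bilin_apply, hℓ, hℓV, hη]
  nlinarith [hH, Kerr.scalarH_nonneg hM a x]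

/-- **A1' (anchor pairing, kernel-checked).** On the same line
`g_{M,a}(y(s))(e₀, V(x)) = −1 − 2H(x) + 2H(x + sℓ♯ₓ) ≤ −1 + 2M/(r(x) + s)`: at an anchor point of radius
`r(x) + s ≥ 100 M` the frozen vector pairs with `e₀` (the SEAMED (5) anchor direction `Λe₀`, unboosted) at most
`−0.98` — same timecone. -/
theorem kerr_bilin_basisVector_frozen_timeVector_le {M a : ℝ} (hM : 0 ≤ M) {x : E4}
    (hr : 0 < Kerr.radius a x) {s : ℝ} (hs : 0 ≤ s) :
    Kerr.bilin M a (x + s • (Kerr.nullVector a x + E4.basisVector 0))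
      (E4.basisVector 0) (Kerr.timeVector M a x) ≤ -1 + 2 * M / (Kerr.radius a x + s) := by
  have hs' : 0 < Kerr.radius a x + s := by linarith
  have hpt : x + s • (Kerr.nullVector a x + E4.basisVector 0) =
      (x + s • Kerr.nullVector a x) + s • E4.basisVector 0 := by
    rw [smul_add, add_assoc]
  rw [hpt, Kerr.bilin_add_smul_basisVector_zero]
  have hry : Kerr.radius a (x + s • Kerr.nullVector a x) = Kerr.radius a x + s :=
    Kerr.radius_add_smul_nullVector hr hs'
  have hry0 : 0 < Kerr.radius a (x + s • Kerr.nullVector a x) := by rw [hry]; exact hs'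
  have hℓ : Kerr.nullCovector a (x + s • Kerr.nullVector a x) = Kerr.nullCovector a x := by
    have h : Kerr.nullCovectorFun a (x + s • Kerr.nullVector a x) = Kerr.nullCovectorFun a x :=
      funext fun μ ↦ Kerr.nullCovectorFun_add_smul_nullVector hr hs' μ
    simp only [Kerr.nullCovector, h]
  have hℓV : Kerr.nullCovector a x (Kerr.timeVector M a x) = 1 := by
    simp only [Kerr.timeVector, map_sub, map_smul, Kerr.nullCovector_basisVector_zero,
      Kerr.nullCovector_nullVector hr, smul_eq_mul, mul_zero, sub_zero]
  have hη : Minkowski.bilin (E4.basisVector 0) (Kerr.timeVector M a x) = -1 - 2 * Kerr.scalarH M a x := by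
    have h := Kerr.bilin_timeVector (M := M) hr (E4.basisVector 0)
    rw [Kerr.bilin_symm, Kerr.bilin_apply, hℓV, Kerr.nullCovector_basisVector_zero] at h
    simp only [mul_one] at h
    have h0 : (E4.basisVector 0 : E4) 0 = 1 := by simp
    rw [h0] at h
    linarith
  have hHy : Kerr.scalarH M a (x + s • Kerr.nullVector a x) ≤ M / (Kerr.radius a x + s) := by
    rw [← hry]; exact Kerr.scalarH_le_div hM a hry0
  have h2 : 2 * M / (Kerr.radius a x + s) = 2 * (M / (Kerr.radius a x + s)) := by ring
  rw [Kerr.bilin_apply, hℓ, hℓV, hη, Kerr.nullCovector_basisVector_zero, h2]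
  nlinarith [hHy, Kerr.scalarH_nonneg hM a x]

/-! ### A2–A4: transport on a segment and the two pointwise conversions -/

/-- **A2 (segment transport).** For a smooth chart `Ψ : B.domain → 𝓢` and a CONSTANT coordinate vector
`W` whose push-forward is causal along a coordinate segment `[x, y] ⊆ B.domain`: future-directed at `y`
⇒ future-directed at `x` (`Spacetime.isFutureDirected_mfderiv_of_isPreconnected` on the convex segment,
through the `Ψ ∘ (chartAt E4 x).symm` glue of `BackgroundChartCalculus`). -/
theorem isFutureDirected_mfderiv_of_segment {𝓢 : Spacetime.{0} 4} (B : ModelBackground)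
    (Ψ : B.domain → 𝓢.carrier) (hΨ : ContMDiff 𝓘(ℝ, E4) (𝓡 4) ∞ Ψ) (x y : B.domain) (W : E4)
    (hseg : segment ℝ (x : E4) (y : E4) ⊆ (B.domain : Set E4))
    (hc : ∀ z : B.domain, (z : E4) ∈ segment ℝ (x : E4) (y : E4) →
      𝓢.metric.IsCausal (mfderiv 𝓘(ℝ, E4) (𝓡 4) Ψ z W))
    (hy : 𝓢.timeOrientation.IsFutureDirected (mfderiv 𝓘(ℝ, E4) (𝓡 4) Ψ y W)) :
    𝓢.timeOrientation.IsFutureDirected (mfderiv 𝓘(ℝ, E4) (𝓡 4) Ψ x W) := by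
  set ψ : E4 → 𝓢.carrier := Ψ ∘ (chartAt E4 x).symm with hψdef
  have hψ : ContMDiffOn 𝓘(ℝ, E4) (𝓡 4) ∞ ψ B.domain := 𝓢.contMDiffOn_comp_chartAt_symm B Ψ x hΨ
  have hd : ∀ (z : E4) (hz : z ∈ (B.domain : Set E4)),
      mfderiv 𝓘(ℝ, E4) (𝓡 4) ψ z W = mfderiv 𝓘(ℝ, E4) (𝓡 4) Ψ ⟨z, hz⟩ W := fun z hz ↦
    𝓢.mfderiv_comp_chartAt_symm_apply B Ψ x hz ((hΨ ⟨z, hz⟩).mdifferentiableAt (by simp)) _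
  have hiff : ∀ (z : E4) (hz : z ∈ (B.domain : Set E4)),
      𝓢.timeOrientation.IsFutureDirected (mfderiv 𝓘(ℝ, E4) (𝓡 4) ψ z W) ↔
        𝓢.timeOrientation.IsFutureDirected (mfderiv 𝓘(ℝ, E4) (𝓡 4) Ψ ⟨z, hz⟩ W) := by
    intro z hz
    have hp : (chartAt E4 x).symm z = ⟨z, hz⟩ := Subtype.ext (OpensChart.chartAt_symm_val x hz)
    rw [hd z hz]
    show 𝓢.timeOrientation.IsFutureDirected (x := Ψ ((chartAt E4 x).symm z)) _ ↔ _
    rw [hp]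
  have hiffc : ∀ (z : E4) (hz : z ∈ (B.domain : Set E4)),
      𝓢.metric.IsCausal (mfderiv 𝓘(ℝ, E4) (𝓡 4) ψ z W) ↔
        𝓢.metric.IsCausal (mfderiv 𝓘(ℝ, E4) (𝓡 4) Ψ ⟨z, hz⟩ W) := by
    intro z hz
    have hp : (chartAt E4 x).symm z = ⟨z, hz⟩ := Subtype.ext (OpensChart.chartAt_symm_val x hz)
    rw [hd z hz]
    show 𝓢.metric.IsCausal (x := Ψ ((chartAt E4 x).symm z)) _ ↔ _
    rw [hp]
  have hc' : ∀ z ∈ segment ℝ (x : E4) (y : E4), 𝓢.metric.IsCausal (mfderiv 𝓘(ℝ, E4) (𝓡 4) ψ z W) :=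
    fun z hz ↦ (hiffc z (hseg hz)).2 (hc ⟨z, hseg hz⟩ hz)
  have hyO : (y : E4) ∈ (B.domain : Set E4) := y.2
  have hxO : (x : E4) ∈ (B.domain : Set E4) := x.2
  have key := 𝓢.isFutureDirected_mfderiv_of_isPreconnected B.domain.2 hψ
    (convex_segment (x : E4) (y : E4)).isPreconnected hseg W hc' (right_mem_segment ℝ (x : E4) y)
    ((hiff y hyO).2 hy) (x : E4) (left_mem_segment ℝ (x : E4) y)
  exact (hiff x hxO).1 key

/-- **A3 (pointwise timelikeness from the `C⁰` deviation).**
`g(dΨ W, dΨ W) = g₀(z)(W, W) + (Ψ^*g − g₀)(z)(W, W) ≤ −m + ε‖W‖² < 0`. -/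
theorem isTimelike_mfderiv_of_norm_deviation_le {𝓢 : Spacetime.{0} 4} (B : ModelBackground)
    (Ψ : B.domain → 𝓢.carrier) (z : B.domain) (W : E4) {m ε : ℝ}
    (hB : B.bilin (z : E4) W W ≤ -m) (hdev : ‖𝓢.deviation B Ψ z‖ ≤ ε) (h : ε * ‖W‖ ^ 2 < m) :
    𝓢.metric.IsTimelike (mfderiv 𝓘(ℝ, E4) (𝓡 4) Ψ z W) := by
  have happ := 𝓢.deviation_apply B Ψ z W W
  have h1 : 𝓢.deviation B Ψ z W W ≤ ‖𝓢.deviation B Ψ z‖ * ‖W‖ * ‖W‖ := by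
    have h0 : ‖𝓢.deviation B Ψ z W W‖ ≤ ‖𝓢.deviation B Ψ z‖ * ‖W‖ * ‖W‖ :=
      ((𝓢.deviation B Ψ z W).le_opNorm W).trans
        (mul_le_mul_of_nonneg_right ((𝓢.deviation B Ψ z).le_opNorm W) (norm_nonneg W))
    exact (Real.le_norm_self _).trans h0
  have h2 : ‖𝓢.deviation B Ψ z‖ * ‖W‖ * ‖W‖ ≤ ε * ‖W‖ ^ 2 := by
    rw [mul_assoc, ← sq]
    exact mul_le_mul_of_nonneg_right hdev (sq_nonneg _)
  show 𝓢.metric.val (Ψ z) (mfderiv 𝓘(ℝ, E4) (𝓡 4) Ψ z W) (mfderiv 𝓘(ℝ, E4) (𝓡 4) Ψ z W) < 0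
  linarith

/-- **A4 (pointwise same-cone conversion).** If `dΨ A` is future-directed timelike, `dΨ W` is causal and
`g(dΨ A, dΨ W) = g₀(z)(A, W) + (Ψ^*g − g₀)(z)(A, W) < 0`, then `dΨ W` is future-directed
(`TimeOrientation.isFutureDirected_of_val_lt_zero`). -/
theorem isFutureDirected_mfderiv_of_pairing_neg {𝓢 : Spacetime.{0} 4} (B : ModelBackground)
    (Ψ : B.domain → 𝓢.carrier) (z : B.domain) (A W : E4)
    (hA : 𝓢.timeOrientation.IsFutureDirected (mfderiv 𝓘(ℝ, E4) (𝓡 4) Ψ z A))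
    (hAt : 𝓢.metric.IsTimelike (mfderiv 𝓘(ℝ, E4) (𝓡 4) Ψ z A))
    (hW : 𝓢.metric.IsCausal (mfderiv 𝓘(ℝ, E4) (𝓡 4) Ψ z W))
    (hneg : B.bilin (z : E4) A W + 𝓢.deviation B Ψ z A W < 0) :
    𝓢.timeOrientation.IsFutureDirected (mfderiv 𝓘(ℝ, E4) (𝓡 4) Ψ z W) := by
  refine 𝓢.timeOrientation.isFutureDirected_of_val_lt_zero hA hAt hW ?_
  have happ := 𝓢.deviation_apply B Ψ z A W
  linarith

end Summit.FinalStateConjecture.FinalStateConjecture.Cruxes.FutureOrientedOfSeamed.Ideator1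

end
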